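import Summits.ResolutionOfSingularities.ResolutionOfSingularities.Theses.SharpStrata
import Summits.ResolutionOfSingularities.ResolutionOfSingularities.Theses.IsolatedCore
import Literature.AlgebraicGeometry.Resolution.AlterationsResolution
import Literature.AlgebraicGeometry.Resolution.RegularLocusOpen
import Literature.AlgebraicGeometry.Resolution.QuasiExcellentField
import Literature.AlgebraicGeometry.Resolution.GeneralLUProofs
import HarnessLib

/-!
# Crux `SharpStrata.ResSepExc` (stmt-16829) against route `IsolatedCore` (stmt-18020 `W`,
# stmt-18021 `K`): the line `registered` is dominated by `W ∧ K`, and the crux dominates the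
# integral perfect-field case of `K`

Route files: `Theses/SharpStrata.lean` (crux `ResSepExc`: separably exceptional integral
varieties over perfect fields of characteristic `p` are resolvable) and `Theses/IsolatedCore.lean`
(crux `FiniteSingularModels` = W: every reduced separated finite-type scheme over a field of
characteristic `p` has a proper birational REDUCED model with finitely many non-regular points;
crux `IsolatedResolution` = K: such finite-singular-locus schemes are resolvable). The lead's line
for `ResSepExc` (`Cruxes/ResSepExc/Lines/birth.lean`) cuts the crux into
`stub_isolateSingularities` (a proper birational integral model every point of which is regular
or closed) and `stub_isolatedResolution` (such models over perfect fields are resolvable). This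
file records, kernel-checked, how the two cuts compare — every theorem PROVED, no new definition:

* `regular_or_isClosed_of_finite_nonRegular` — for a scheme locally of finite type over a field,
  finitely many non-regular points ⇒ every point is regular or closed (regular locus open over the
  quasi-excellent base; a finite closed subset of a Jacobson space consists of closed points).
* `finite_nonRegular_of_regular_or_isClosed` — conversely, for a scheme of finite type over a
  field, if every point is regular or closed then the non-regular points form a finite set (the
  non-regular locus is closed in a Noetherian sober space and each of its irreducible closed
  pieces is the closure of a generic point which is a closed point). So "isolated singularities"
  in the sense of the line (`IsolatedSing`) and in the sense of route `IsolatedCore`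
  (`{x | ¬ regular}.Finite`) agree on schemes of finite type over a field.
* `exists_model_regular_or_isClosed_of_finiteSingularModels` — **W closes the first stub, with
  the hypotheses `SepExc X` and `PerfectField k` idle**: from W, every integral separated
  finite-type `X` over any field of characteristic `p` has a proper birational INTEGRAL model all
  of whose points are regular or closed.
* `hasResolution_of_isolatedResolution_of_regular_or_isClosed` — **K closes the second stub**
  (over any field): an integral separated finite-type scheme every point of which is regular or
  closed is resolvable under K.
* `resSepExc_of_finiteSingularModels_of_isolatedResolution` — hence **`W → K → ResSepExc`**
  directly (model, resolve, transport along the proper birational map by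
  `ComponentGluing.Scheme.HasResolution.of_isBirational`), without passing through the summit.
* `hasResolution_of_resSepExc_of_finite_nonRegular` — conversely **the crux `ResSepExc` closes
  the integral, perfect-field case of K**: an integral separated finite-type scheme over a
  perfect field of characteristic `p` with finitely many non-regular points is separably
  exceptional vacuously (every point regular or closed), so `ResSepExc` resolves it.

Net: on integral schemes over perfect fields, `stub_isolatedResolution` ⟺ K and
`stub_isolateSingularities` ⟸ W; the crux sits between K (integral, perfect fields) and W ∧ K.
-/

noncomputable section

-- single-problem summit: the doubled namespace component `ResolutionOfSingularities` is forced
set_option linter.dupNamespace false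

open CategoryTheory AlgebraicGeometry TopologicalSpace Literature.AlgebraicGeometry.Resolution
open Summit.ResolutionOfSingularities.ResolutionOfSingularities.Theses

namespace Summit.ResolutionOfSingularities.ResolutionOfSingularities.Theorems.SharpStrata

/-! ## Finite non-regular locus ⟺ every point regular or closed (finite type over a field) -/

/-- Over a field `k`, the base `Spec k` is quasi-excellent, so the non-regular locus of a scheme
locally of finite type over `k` is closed. [cite: Matsumura1987, §32] -/
theorem isClosed_compl_regularLocus_of_field {k : Type} [Field k] (Y : Scheme.{0})
    (g : Y ⟶ Spec (.of k)) [LocallyOfFiniteType g] : IsClosed (Scheme.regularLocus Y)ᶜ :=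
  isClosed_compl_regularLocus_of_locallyOfFiniteType g
    (Scheme.isQuasiExcellent_of_locallyOfFiniteType_of_isQuasiExcellentRing Stacks07QU_holds
      (isQuasiExcellentRing_of_field k) (𝟙 _))

/-- For a scheme locally of finite type over a field, **finitely many non-regular points ⇒ every
point is regular or closed**: the regular locus is open, so the closure of a non-regular point
`ζ` lies in the finite non-regular set; in the Jacobson space `Y` the closed points of that
finite closed set are dense in it, and a finite union of closed points is closed, so `ζ` itself
is a closed point. [folklore] -/
theorem regular_or_isClosed_of_finite_nonRegular {k : Type} [Field k] (Y : Scheme.{0})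
    (g : Y ⟶ Spec (.of k)) [LocallyOfFiniteType g]
    (hfin : {y : Y | ¬ IsRegularLocalRing (Y.presheaf.stalk y)}.Finite) (ζ : Y) :
    IsRegularLocalRing (Y.presheaf.stalk ζ) ∨ IsClosed ({ζ} : Set Y) := by
  by_cases hζ : IsRegularLocalRing (Y.presheaf.stalk ζ)
  · exact Or.inl hζ
  right
  have hcl : IsClosed (Scheme.regularLocus Y)ᶜ := isClosed_compl_regularLocus_of_field Y g
  have hsub : closure ({ζ} : Set Y) ⊆ (Scheme.regularLocus Y)ᶜ :=
    closure_minimal (Set.singleton_subset_iff.mpr hζ) hcl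
  have hZfin : (closure ({ζ} : Set Y)).Finite := hfin.subset (hsub.trans fun y hy => hy)
  haveI : JacobsonSpace Y := LocallyOfFiniteType.jacobsonSpace g
  have hC : IsClosed (closure ({ζ} : Set Y) ∩ closedPoints Y) := by
    rw [← Set.biUnion_of_singleton (closure ({ζ} : Set Y) ∩ closedPoints Y)]
    exact (hZfin.subset Set.inter_subset_left).isClosed_biUnion fun x hx => hx.2
  have hJ : closure (closure ({ζ} : Set Y) ∩ closedPoints Y) = closure ({ζ} : Set Y) :=
    closure_inter_closedPoints isClosed_closure
  rw [hC.closure_eq] at hJ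
  have hmem : ζ ∈ closure ({ζ} : Set Y) ∩ closedPoints Y := by
    rw [hJ]; exact subset_closure (Set.mem_singleton ζ)
  exact (mem_closedPoints_iff).mp hmem.2

/-- For a scheme of finite type over a field, **every point regular or closed ⇒ finitely many
non-regular points**: the non-regular locus `N` is closed in the Noetherian space `Y`, hence a
finite union of irreducible closed sets; each of these is the closure of its generic point
(schemes are sober), a non-regular hence closed point, so each piece is a singleton. [folklore] -/
theorem finite_nonRegular_of_regular_or_isClosed {k : Type} [Field k] (Y : Scheme.{0})
    (g : Y ⟶ Spec (.of k)) [LocallyOfFiniteType g] [QuasiCompact g]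
    (h : ∀ ζ : Y, IsRegularLocalRing (Y.presheaf.stalk ζ) ∨ IsClosed ({ζ} : Set Y)) :
    {y : Y | ¬ IsRegularLocalRing (Y.presheaf.stalk y)}.Finite := by
  haveI : IsLocallyNoetherian Y := LocallyOfFiniteType.isLocallyNoetherian g
  haveI : CompactSpace Y := QuasiCompact.compactSpace_of_compactSpace g
  haveI : IsNoetherian Y := {}
  have hcl : IsClosed {y : Y | ¬ IsRegularLocalRing (Y.presheaf.stalk y)} :=
    isClosed_compl_regularLocus_of_field Y g
  obtain ⟨S, hSfin, hSclosed, hSirr, hNS⟩ :=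
    NoetherianSpace.exists_finite_set_isClosed_irreducible hcl
  rw [hNS]
  refine hSfin.sUnion fun t ht => ?_
  -- `t` is irreducible and closed, with generic point `η ∈ t ⊆ N`; `η` is closed, so `t = {η}`
  set η := (hSirr t ht).genericPoint with hη
  have hct : closure ({η} : Set Y) = t := (hSirr t ht).closure_genericPoint (hSclosed t ht)
  have hηt : η ∈ t := hct ▸ subset_closure (Set.mem_singleton η)
  have hηN : ¬ IsRegularLocalRing (Y.presheaf.stalk η) := by
    have : η ∈ ⋃₀ S := Set.mem_sUnion_of_mem hηt ht
    rw [← hNS] at this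
    exact this
  have hηc : IsClosed ({η} : Set Y) := (h η).resolve_left hηN
  rw [← hct, hηc.closure_eq]
  exact Set.finite_singleton η

/-! ## `W` closes the first stub (`SepExc`, `PerfectField` idle); `K` closes the second -/

/-- **`IsolatedCore.FiniteSingularModels` (W, stmt-18020) gives isolated-singularity models of
integral varieties**, with no hypothesis on the variety or the ground field: the reduced model
with finitely many non-regular points is integral (`IsBirational.isIntegral`) and every point of
it is regular or closed (`regular_or_isClosed_of_finite_nonRegular` for `π ≫ f`). In particular W
implies the registered stub `stub_isolateSingularities` of crux stmt-16829, whose extra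
hypotheses (`SepExc X`, `PerfectField k`) are not used. [folklore] -/
theorem exists_model_regular_or_isClosed_of_finiteSingularModels
    (hW : IsolatedCore.FiniteSingularModels) {p : ℕ} (hp : p.Prime) (k : Type) [Field k]
    [CharP k p] (X : Scheme.{0}) [IsIntegral X] (f : X ⟶ Spec (.of k)) [IsSeparated f]
    [LocallyOfFiniteType f] [QuasiCompact f] :
    ∃ (X' : Scheme.{0}) (_ : IsIntegral X') (π : X' ⟶ X), IsProper π ∧ IsBirational π ∧
      ∀ ζ : X', IsRegularLocalRing (X'.presheaf.stalk ζ) ∨ IsClosed ({ζ} : Set X') := by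
  obtain ⟨X', π, hπ, hb, hred, hfin⟩ := hW p hp k X f ‹_› ‹_› ‹_› inferInstance
  haveI := hred; haveI := hπ
  haveI : IsIntegral X' := hb.isIntegral
  exact ⟨X', inferInstance, π, hπ, hb, regular_or_isClosed_of_finite_nonRegular X' (π ≫ f) hfin⟩

/-- **`IsolatedCore.IsolatedResolution` (K, stmt-18021) resolves every integral separated
finite-type scheme over a field of characteristic `p` all of whose points are regular or closed**
(its non-regular set is finite, `finite_nonRegular_of_regular_or_isClosed`). In particular K
implies the registered stub `stub_isolatedResolution` of crux stmt-16829 (which asks this over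
perfect fields only). [folklore] -/
theorem hasResolution_of_isolatedResolution_of_regular_or_isClosed
    (hK : IsolatedCore.IsolatedResolution) {p : ℕ} (hp : p.Prime) (k : Type) [Field k]
    [CharP k p] (X : Scheme.{0}) [IsIntegral X] (f : X ⟶ Spec (.of k)) [IsSeparated f]
    [LocallyOfFiniteType f] [QuasiCompact f]
    (h : ∀ ζ : X, IsRegularLocalRing (X.presheaf.stalk ζ) ∨ IsClosed ({ζ} : Set X)) :
    Scheme.HasResolution X :=
  hK p hp k X f ‹_› ‹_› ‹_› inferInstance (finite_nonRegular_of_regular_or_isClosed X f h)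

/-- **`W → K → ResSepExc`, directly**: take the isolated-singularity model `π : X' → X` from W,
resolve `X'` by K (its structure map `π ≫ f` is separated, locally of finite type and
quasi-compact since `π` is proper), and transport the resolution down the proper birational `π`
(`ComponentGluing.Scheme.HasResolution.of_isBirational`). The hypotheses `SepExc X` and
`PerfectField k` of the crux are idle in this derivation: the crux of route `SharpStrata` is
dominated by the two cruxes of route `IsolatedCore`. [folklore] -/
theorem resSepExc_of_finiteSingularModels_of_isolatedResolution
    (hW : IsolatedCore.FiniteSingularModels) (hK : IsolatedCore.IsolatedResolution) :
    SharpStrata.ResSepExc := by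
  intro p hp k _ _ _ X _ f hs hl hq _
  haveI := hs; haveI := hl; haveI := hq
  obtain ⟨X', hX', π, hπ, hb, hiso⟩ :=
    exists_model_regular_or_isClosed_of_finiteSingularModels hW hp k X f
  haveI := hX'; haveI := hπ
  refine ComponentGluing.Scheme.HasResolution.of_isBirational π hb ?_
  exact hasResolution_of_isolatedResolution_of_regular_or_isClosed hK hp k X' (π ≫ f) hiso

/-! ## Conversely: the crux closes the integral perfect-field case of `K` -/

/-- **`ResSepExc` resolves integral varieties with finitely many non-regular points over perfect
fields** (the integral, perfect-field case of `IsolatedCore.IsolatedResolution`): every point of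
such an `X` is regular or closed (`regular_or_isClosed_of_finite_nonRegular`), so `X` is
separably exceptional through the first two disjuncts and the crux applies. [folklore] -/
theorem hasResolution_of_resSepExc_of_finite_nonRegular (hR : SharpStrata.ResSepExc) {p : ℕ}
    (hp : p.Prime) (k : Type) [Field k] [CharP k p] [PerfectField k] (X : Scheme.{0})
    [IsIntegral X] (f : X ⟶ Spec (.of k)) [IsSeparated f] [LocallyOfFiniteType f]
    [QuasiCompact f] (hfin : {x : X | ¬ IsRegularLocalRing (X.presheaf.stalk x)}.Finite) :
    Scheme.HasResolution X :=
  hR p hp k X f ‹_› ‹_› ‹_› fun ζ =>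
    (regular_or_isClosed_of_finite_nonRegular X f hfin ζ).elim Or.inl fun hc => Or.inr (Or.inl hc)

end Summit.ResolutionOfSingularities.ResolutionOfSingularities.Theorems.SharpStrata

end
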